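import Summits.CriticalPhenomena.PercolationContinuityZ3.Theses.PercNonProliferation
import Literature.Barriers.CriticalPhenomena.SpanningClustersAboveSix
import Literature.Probability.Percolation.SupercriticalClusterTransienceSeeds
import Literature.Probability.Percolation.GMFiniteSize
import Literature.Probability.Percolation.SharpnessDCTProofs

/-!
# `SubpolynomialBlocking` — negative knowledge I: the crux lives exactly at `p = p_c`

Support file for crux item stmt-CriticalPhenomena-4446 (`PercNonProliferation.SubpolynomialBlocking`:
`∀ s > 0, ∀ᶠ n, n^{-s} ≤ u_n`, `u_n = P_{p_c(ℤ³)}(Λ_n ↮ ∂ⁱⁿΛ_{2n} in Λ_{2n})`), written by the crux's standing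
disprover (Cruxes/SubpolynomialBlocking/Disproof.lean, §1–§3). It frees the two parameters of the crux
(`SubpolynomialBlockingAt d p`; the crux is the instance `d = 3, p = p_c`, `crux_iff`) and PROVES:

* `p = p_c` is LOAD-BEARING FROM ABOVE: for every `d ≥ 3` and every `p > p_c(ℤ^d)` the blocking probability is
  exponentially small (`blockProb_le_exp_of_criticalProb_lt`, GKZ 1993 Lemma 5 via the Grimmett–Marstrand slab
  theorem, in tree), so the `(d,p)`-statement is FALSE (`not_subpolynomialBlockingAt_of_criticalProb_lt`) and the
  crux has no open neighbourhood in `p` (`not_exists_nhds_criticalProb`);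
* `p = p_c` is NOT load-bearing from below: for `d ≥ 2` and `p < p_c(ℤ^d)` the statement is TRUE
  (`subpolynomialBlockingAt_of_lt_criticalProb`, `P_p(cross_n) ≤ (2n+1)^d e^{-cn}` by sharpness, in tree);
* hence on `ℤ³`, for `p ≠ p_c`: `SubpolynomialBlockingAt 3 p ↔ p < p_c` (`subpolynomialBlockingAt_three_iff_of_ne`).

Consequence for provers: any proof of the crux must use `p ≤ p_c`, and cannot be a perturbative/openness argument.
-/

noncomputable section

namespace Summit.CriticalPhenomena.PercolationContinuityZ3.Theorems.SubpolynomialBlocking.Negative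

open MeasureTheory Filter Topology
open Literature.Probability.Percolation Literature.Probability.LatticeModels
open Literature.Barriers.CriticalPhenomena
open Literature.Probability.Percolation.DCT16
open Summit.CriticalPhenomena.PercolationContinuityZ3.Theses

/-! ## §1 Bookkeeping: the parametrised crux, the blocking probability, measurability -/

/-- The crux with the dimension `d` and the parameter `p` freed:
`∀ s > 0, ∀ᶠ n, n^{-s} ≤ P_p(Λ_n ↮ ∂ⁱⁿΛ_{2n} in Λ_{2n})` on `ℤ^d`. The crux is the instance
`d = 3`, `p = p_c(ℤ³)` (`crux_iff`). -/
def SubpolynomialBlockingAt (d : ℕ) (p : unitInterval) : Prop :=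
  ∀ s : ℝ, 0 < s → ∀ᶠ n : ℕ in atTop, (n : ℝ) ^ (-s) ≤
    (bondPercolation (zdGraph d) p).real {ω | ¬ ∃ x ∈ box d n,
      ∃ y ∈ innerBoundary (zdGraph d) (box d (2 * n)),
        ω ∈ openConnIn (↑(box d (2 * n)) : Set (Site d)) x y}

/-- The blocking probability `u_n(d, p) = P_p((annulusCrossing d n)ᶜ)`. -/
def blockProb (d : ℕ) (p : unitInterval) (n : ℕ) : ℝ :=
  (bondPercolation (zdGraph d) p).real (annulusCrossing d n)ᶜ

/-- The crux IS `SubpolynomialBlockingAt 3 p_c` (definitional). -/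
theorem crux_iff :
    PercNonProliferation.SubpolynomialBlocking ↔ SubpolynomialBlockingAt 3 (criticalProbI 3) :=
  Iff.rfl

/-- The crux's event is the complement of the barrier file's `annulusCrossing` (definitional). -/
theorem blockingEvent_eq (d n : ℕ) :
    {ω : BondConfig (Site d) | ¬ ∃ x ∈ box d n, ∃ y ∈ innerBoundary (zdGraph d) (box d (2 * n)),
      ω ∈ openConnIn (↑(box d (2 * n)) : Set (Site d)) x y} = (annulusCrossing d n)ᶜ :=
  rfl

/-- `SubpolynomialBlockingAt` through `blockProb` (definitional). -/
theorem subpolynomialBlockingAt_iff (d : ℕ) (p : unitInterval) :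
    SubpolynomialBlockingAt d p ↔
      ∀ s : ℝ, 0 < s → ∀ᶠ n : ℕ in atTop, (n : ℝ) ^ (-s) ≤ blockProb d p n :=
  Iff.rfl

/-- `annulusCrossing` as a finite union of box-connection events. -/
theorem annulusCrossing_eq_iUnion (d n : ℕ) :
    annulusCrossing d n = ⋃ x ∈ box d n, ⋃ y ∈ innerBoundary (zdGraph d) (box d (2 * n)),
      openConnIn (↑(box d (2 * n)) : Set (Site d)) x y := by
  ext ω
  simp only [annulusCrossing, Set.mem_setOf_eq, Set.mem_iUnion, exists_prop]

/-- The annulus-crossing event is measurable. -/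
theorem measurableSet_annulusCrossing (d n : ℕ) : MeasurableSet (annulusCrossing d n) := by
  rw [annulusCrossing_eq_iUnion]
  exact Finset.measurableSet_biUnion _ fun x _ =>
    Finset.measurableSet_biUnion _ fun y _ => measurableSet_openConnIn _ x y

/-- `u_n = 1 - P(cross)`. -/
theorem blockProb_eq (d : ℕ) (p : unitInterval) (n : ℕ) :
    blockProb d p n = 1 - (bondPercolation (zdGraph d) p).real (annulusCrossing d n) :=
  probReal_compl_eq_one_sub (measurableSet_annulusCrossing d n)

/-- `0 ≤ u_n`. -/
theorem blockProb_nonneg (d : ℕ) (p : unitInterval) (n : ℕ) : 0 ≤ blockProb d p n :=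
  measureReal_nonneg

/-- `u_n ≤ 1`. -/
theorem blockProb_le_one (d : ℕ) (p : unitInterval) (n : ℕ) : blockProb d p n ≤ 1 :=
  measureReal_le_one

/-! ## §2 Load-bearing: criticality from above (`p > p_c` kills the statement, every `d ≥ 3`) -/

/-- An infinite open (lattice) cluster at a point of `Λ_n` crosses the annulus inside `Λ_{2n}`. -/
theorem mem_annulusCrossing_of_percolatesAt {d n : ℕ} {ω : BondConfig (Site d)}
    (hω : ω ⊆ (zdGraph d).edgeSet) {x : Site d} (hx : x ∈ box d n) (h : ω ∈ percolatesAt x) :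
    ω ∈ annulusCrossing d n :=
  ⟨x, hx, toBdry_of_percolatesAt (box_subset_box_two_mul d n hx) hω h⟩

/-- On lattice configurations, blocking forces `Λ_n ↮ ∞` (GKZ's `noPercolation`). -/
theorem mem_noPercolation_of_not_mem_annulusCrossing {d n : ℕ} {ω : BondConfig (Site d)}
    (hω : ω ⊆ (zdGraph d).edgeSet) (h : ω ∈ (annulusCrossing d n)ᶜ) :
    ω ∈ GKZ.noPercolation (GM.ball (0 : Site d) n) := by
  intro z hz hperc
  refine h (mem_annulusCrossing_of_percolatesAt hω ?_ hperc)
  rw [GM.mem_ball] at hz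
  rw [mem_box]
  intro i
  simpa using hz i

/-- **Supercritical annuli are crossed up to an exponentially small error**: for `d ≥ 3` and
`p > p_c(ℤ^d)` there is `γ > 0` with `u_n(d,p) ≤ e^{-γ n}` for all `n`
(GKZ 1993 Lemma 5, `GKZ.exists_real_noPercolation_ball_le_exp`, in tree). -/
theorem blockProb_le_exp_of_criticalProb_lt {d : ℕ} (hd : 3 ≤ d) (p : unitInterval)
    (hp : criticalProb (zdGraph d) (0 : Site d) < p) :
    ∃ γ : ℝ, 0 < γ ∧ ∀ n : ℕ, blockProb d p n ≤ Real.exp (-(γ * n)) := by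
  obtain ⟨γ, hγ, h⟩ := GKZ.exists_real_noPercolation_ball_le_exp hd p hp
  refine ⟨γ, hγ, fun n => le_trans ?_ (h 0 n)⟩
  exact real_mono_of_forall_subset_edgeSet (zdGraph d) p
    fun ω hω hb => mem_noPercolation_of_not_mem_annulusCrossing hω hb

/-- `e^{γ n} > n` for `n` large (`n > 4/γ²` suffices). -/
theorem exp_neg_mul_lt_inv {γ : ℝ} (hγ : 0 < γ) {n : ℕ} (hn : 4 / γ ^ 2 < n) :
    Real.exp (-(γ * n)) < ((n : ℝ))⁻¹ := by
  have hn0 : (0 : ℝ) < n := lt_trans (by positivity) hn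
  have h1 : γ * n / 2 + 1 ≤ Real.exp (γ * n / 2) := Real.add_one_le_exp _
  have h2 : Real.exp (γ * n) = Real.exp (γ * n / 2) ^ 2 := by
    rw [← Real.exp_nat_mul]; ring_nf
  have h3 : (n : ℝ) < (γ * n / 2) ^ 2 := by
    have : 4 < γ ^ 2 * n := by rw [div_lt_iff₀ (by positivity)] at hn; linarith
    nlinarith
  have h4 : (γ * n / 2) ^ 2 ≤ Real.exp (γ * n) := by
    rw [h2]
    exact pow_le_pow_left₀ (by positivity) (le_trans (by linarith) h1) 2
  rw [Real.exp_neg, inv_lt_inv₀ (Real.exp_pos _) hn0]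
  linarith

/-- **`p = p_c` is load-bearing from above**: for `d ≥ 3` and every `p > p_c(ℤ^d)` the
`(d, p)`-crux is FALSE (take `s = 1`: `n^{-1} ≤ u_n ≤ e^{-γ n}` fails for large `n`). -/
theorem not_subpolynomialBlockingAt_of_criticalProb_lt {d : ℕ} (hd : 3 ≤ d) (p : unitInterval)
    (hp : criticalProb (zdGraph d) (0 : Site d) < p) : ¬ SubpolynomialBlockingAt d p := by
  intro h
  obtain ⟨γ, hγ, hb⟩ := blockProb_le_exp_of_criticalProb_lt hd p hp
  have h1 := (subpolynomialBlockingAt_iff d p).1 h 1 one_pos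
  rw [eventually_atTop] at h1
  obtain ⟨N, hN⟩ := h1
  set n : ℕ := max N (⌈4 / γ ^ 2⌉₊ + 1) with hn
  have hnN : N ≤ n := le_max_left _ _
  have hn4 : 4 / γ ^ 2 < n := by
    have : (⌈4 / γ ^ 2⌉₊ : ℝ) + 1 ≤ n := by
      rw [hn]; exact_mod_cast le_max_right _ _
    linarith [Nat.le_ceil (4 / γ ^ 2)]
  have hA := hN n hnN
  rw [Real.rpow_neg_one] at hA
  linarith [hb n, exp_neg_mul_lt_inv hγ hn4]

/-- In particular on `ℤ³`: every `p > p_c(ℤ³)` falsifies the statement. -/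
theorem not_subpolynomialBlockingAt_three_of_criticalProb_lt (p : unitInterval)
    (hp : criticalProb (zdGraph 3) (0 : Site 3) < p) : ¬ SubpolynomialBlockingAt 3 p :=
  not_subpolynomialBlockingAt_of_criticalProb_lt le_rfl p hp

/-- **No robustness in `p`**: there is no `δ > 0` such that the statement holds for all
`p` within `δ` of `p_c(ℤ³)` (refuted strengthening "the property is open at `p_c`"). -/
theorem not_exists_nhds_criticalProb :
    ¬ ∃ δ : ℝ, 0 < δ ∧ ∀ p : unitInterval,
      |(p : ℝ) - criticalProb (zdGraph 3) (0 : Site 3)| < δ → SubpolynomialBlockingAt 3 p := by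
  rintro ⟨δ, hδ, h⟩
  set pc : ℝ := criticalProb (zdGraph 3) (0 : Site 3) with hpc
  have hpc1 : pc < 1 := criticalProb_zd_lt_one (by norm_num)
  have hpc0 : 0 ≤ pc := (criticalProb_mem_Icc (zdGraph 3) (0 : Site 3)).1
  set q : ℝ := min (pc + δ / 2) 1 with hq
  have hq01 : q ∈ unitInterval := ⟨le_min (by linarith) zero_le_one, min_le_right _ _⟩
  have hqgt : pc < q := lt_min (by linarith) hpc1
  have hqδ : |q - pc| < δ := by
    rw [abs_of_pos (by linarith)]
    have : q ≤ pc + δ / 2 := min_le_left _ _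
    linarith
  exact not_subpolynomialBlockingAt_three_of_criticalProb_lt ⟨q, hq01⟩ hqgt (h ⟨q, hq01⟩ hqδ)

/-! ## §3 Not load-bearing from below: for `p < p_c` the statement is TRUE (every `d ≥ 2`) -/

/-- Geometry: a vertex of `∂ⁱⁿΛ_{2n}`, seen from a point `x ∈ Λ_n`, is outside the open box
`x + Λ_n` or on its boundary. -/
theorem sub_notMem_or_mem_innerBoundary {d n : ℕ} {x w : Site d} (hx : x ∈ box d n)
    (hw : w ∈ innerBoundary (zdGraph d) (box d (2 * n))) :
    w - x ∉ box d n ∨ w - x ∈ innerBoundary (zdGraph d) (box d n) := by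
  by_cases hwx : w - x ∈ box d n
  · right
    obtain ⟨i, hi⟩ := exists_eq_of_mem_innerBoundary_box hw
    refine mem_innerBoundary_box_of_natAbs_eq hwx (i := i) ?_
    have h1 := (mem_box.1 hx) i
    have h2 := (mem_box.1 hwx) i
    simp only [Pi.sub_apply] at h2 ⊢
    push_cast at hi h1 h2
    omega
  · exact Or.inl hwx

/-- On lattice configurations an annulus crossing from `x ∈ Λ_n` contains an arm
`x ↔ x + ∂Λ_n` (first exit from `x + Λ_n`). -/
theorem exists_armEvent_of_mem_annulusCrossing {d n : ℕ} {ω : BondConfig (Site d)}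
    (hω : ω ⊆ (zdGraph d).edgeSet) (h : ω ∈ annulusCrossing d n) :
    ∃ x ∈ box d n, ω ∈ armEvent x n := by
  obtain ⟨x, hx, w, hw, hxw⟩ := h
  exact ⟨x, hx, armEvent_of_pathIn hω (mem_openConnIn_iff_pathIn.1 hxw)
    (sub_notMem_or_mem_innerBoundary hx hw)⟩

/-- **Union bound**: `P_p(cross_n) ≤ |Λ_n| · P_p(0 ↔ ∂Λ_n)` for every `d`, `p`, `n`. -/
theorem real_annulusCrossing_le_card_mul (d : ℕ) (p : unitInterval) (n : ℕ) :
    (bondPercolation (zdGraph d) p).real (annulusCrossing d n) ≤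
      (box d n).card * (bondPercolation (zdGraph d) p).real (siteToBoundary d n) := by
  calc (bondPercolation (zdGraph d) p).real (annulusCrossing d n)
      ≤ (bondPercolation (zdGraph d) p).real (⋃ x ∈ box d n, armEvent x n) :=
        real_mono_of_forall_subset_edgeSet (zdGraph d) p fun ω hω h => by
          obtain ⟨x, hx, hxa⟩ := exists_armEvent_of_mem_annulusCrossing hω h
          exact Set.mem_biUnion (Finset.mem_coe.2 hx) hxa
    _ ≤ ∑ x ∈ box d n, (bondPercolation (zdGraph d) p).real (armEvent x n) :=
        measureReal_biUnion_finset_le _ _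
    _ = (box d n).card * (bondPercolation (zdGraph d) p).real (siteToBoundary d n) := by
        simp_rw [real_armEvent]
        rw [Finset.sum_const, nsmul_eq_mul]

/-- **Subcritical annuli are blocked up to an exponentially small error**: for `d ≥ 2` and
`p < p_c(ℤ^d)` there is `c > 0` with `P_p(cross_n) ≤ (2n+1)^d e^{-cn}` (sharpness, in tree). -/
theorem real_annulusCrossing_le_of_lt_criticalProb {d : ℕ} (hd : 2 ≤ d) (p : unitInterval)
    (hp : (p : ℝ) < criticalProb (zdGraph d) (0 : Site d)) :
    ∃ c : ℝ, 0 < c ∧ ∀ n : ℕ, (bondPercolation (zdGraph d) p).real (annulusCrossing d n) ≤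
      (2 * n + 1 : ℝ) ^ d * Real.exp (-c * n) := by
  obtain ⟨c, hc, h⟩ := perc_sharpness_holds hd p hp
  refine ⟨c, hc, fun n => le_trans (real_annulusCrossing_le_card_mul d p n) ?_⟩
  rw [card_box]
  push_cast
  exact mul_le_mul_of_nonneg_left (h n) (by positivity)

/-- `(2n+1)^d e^{-cn} → 0`. -/
theorem tendsto_pow_mul_exp_neg {c : ℝ} (hc : 0 < c) (d : ℕ) :
    Tendsto (fun n : ℕ => (2 * n + 1 : ℝ) ^ d * Real.exp (-c * n)) atTop (𝓝 0) := by
  -- `(c n)^d e^{-c n} → 0`, and `(2n+1)^d ≤ (3/c)^d (cn)^d` for `n ≥ 1`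
  have h1 : Tendsto (fun n : ℕ => (c * n) ^ d * Real.exp (-(c * n))) atTop (𝓝 0) :=
    (Real.tendsto_pow_mul_exp_neg_atTop_nhds_zero d).comp
      (tendsto_natCast_atTop_atTop.const_mul_atTop hc)
  have h2 : Tendsto (fun n : ℕ => (3 / c) ^ d * ((c * n) ^ d * Real.exp (-(c * n)))) atTop (𝓝 0) := by
    simpa using h1.const_mul ((3 / c) ^ d)
  refine tendsto_of_tendsto_of_tendsto_of_le_of_le' tendsto_const_nhds h2
    (Eventually.of_forall fun n => by positivity) ?_
  filter_upwards [eventually_ge_atTop 1] with n hn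
  have hn1 : (1 : ℝ) ≤ n := by exact_mod_cast hn
  have hle : (2 * n + 1 : ℝ) ≤ 3 / c * (c * n) := by
    rw [div_mul_eq_mul_div, mul_comm c, ← mul_assoc, mul_div_assoc, div_self hc.ne', mul_one]
    linarith
  have hpow : (2 * n + 1 : ℝ) ^ d ≤ (3 / c) ^ d * (c * n) ^ d := by
    rw [← mul_pow]; exact pow_le_pow_left₀ (by positivity) hle d
  calc (2 * n + 1 : ℝ) ^ d * Real.exp (-c * n)
      ≤ (3 / c) ^ d * (c * n) ^ d * Real.exp (-c * n) :=
        mul_le_mul_of_nonneg_right hpow (Real.exp_pos _).le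
    _ = (3 / c) ^ d * ((c * n) ^ d * Real.exp (-(c * n))) := by rw [neg_mul, mul_assoc]

/-- **Below `p_c` the statement is TRUE** (so `p = p_c` is not load-bearing from below): for
`d ≥ 2`, `p < p_c(ℤ^d)`, `u_n → 1`, in particular `u_n ≥ n^{-s}` eventually for every `s > 0`. -/
theorem subpolynomialBlockingAt_of_lt_criticalProb {d : ℕ} (hd : 2 ≤ d) (p : unitInterval)
    (hp : (p : ℝ) < criticalProb (zdGraph d) (0 : Site d)) : SubpolynomialBlockingAt d p := by
  rw [subpolynomialBlockingAt_iff]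
  intro s hs
  obtain ⟨c, hc, h⟩ := real_annulusCrossing_le_of_lt_criticalProb hd p hp
  have hA : ∀ᶠ n : ℕ in atTop, (2 * n + 1 : ℝ) ^ d * Real.exp (-c * n) < 1 / 2 :=
    (tendsto_pow_mul_exp_neg hc d).eventually (gt_mem_nhds (by norm_num))
  have hB : ∀ᶠ n : ℕ in atTop, (n : ℝ) ^ (-s) < 1 / 2 :=
    ((tendsto_rpow_neg_atTop hs).comp tendsto_natCast_atTop_atTop).eventually (gt_mem_nhds (by norm_num))
  filter_upwards [hA, hB] with n hA hB
  rw [blockProb_eq]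
  linarith [h n]

/-- The three regimes on `ℤ³` in one statement: TRUE below `p_c`, FALSE above `p_c`
(the crux is the remaining boundary case `p = p_c`). -/
theorem subpolynomialBlockingAt_three_iff_of_ne (p : unitInterval)
    (hp : (p : ℝ) ≠ criticalProb (zdGraph 3) (0 : Site 3)) :
    SubpolynomialBlockingAt 3 p ↔ (p : ℝ) < criticalProb (zdGraph 3) (0 : Site 3) := by
  rcases lt_or_gt_of_ne hp with h | h
  · exact ⟨fun _ => h, fun _ => subpolynomialBlockingAt_of_lt_criticalProb (by norm_num) p h⟩
  · exact ⟨fun hS => absurd hS (not_subpolynomialBlockingAt_three_of_criticalProb_lt p h),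
      fun h' => absurd h (not_lt.2 h'.le)⟩


end Summit.CriticalPhenomena.PercolationContinuityZ3.Theorems.SubpolynomialBlocking.Negative
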